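import Literature.NumberTheory.EllipticCurves.PadicSigmaSqMinusTwist
import Literature.NumberTheory.EllipticCurves.FormalGroupNegOmegaProofs
import HarnessLib

/-!
# Even formal series are series in `1/x`: existence and uniqueness of the `x⁻¹`-expansion
# (`W.IsInvXExpansion`), and non-junkness of `padicSigmaSqInvX` (proofs only)

Topic `Literature/NumberTheory/EllipticCurves` (trunk T-NT-EC); PROOFS file (theorems only: no
definition, no named fact, no instance — D-0026 net debt 0). Sequel of `PadicSigmaSqMinusTwist.lean`
(typer file of the BSD cell `bsd-print-cf2`, (U5d): `formalInvX = 1/x(z) = z²·w(z)/z³`,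
`IsInvXExpansion Sq S : S(1/x(z)) = Sq(z)`, `padicSigmaSqInvX V p` chosen by `Classical.choose` with junk
`0` when no expansion exists), whose docstring leaves «existence/uniqueness of the `x⁻¹`-expansion (an
`R⟦1/x⟧`-module computation; prover task)» open. This file proves it:

* `formalInvX_subst_formalNeg` — **`1/x` is invariant under the formal inverse**:
  `(1/x)(i(z)) = (1/x)(z)` (from `x(i(z)) = x(z)`, tree `formalXMulSq_subst_formalNeg_mul_X_sq`, and
  `(z²x)·(w/z³) = 1`); hence every `S(1/x)` is EVEN (`IsInvXExpansion.isFormallyEven`).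
* `IsFormallyEven.two_mul_coeff_eq_zero` — **parity**: if `T(i(z)) = T(z)` and `T = c z^m + ⋯` with `m`
  odd then `2c = 0` (the lowest term of `T(i(z))` is `(−1)^m c z^m`, `i(z) = −z + ⋯`).
* `coeff_eq_zero_of_coeff_subst_formalInvX_eq_zero`, `IsInvXExpansion.unique` — **uniqueness**: the
  powers `(1/x)^k = z^{2k}(1 + ⋯)` form a triangular system, so `S ↦ S(1/x)` is injective (any ring).
* `IsFormallyEven.exists_isInvXExpansion`, `IsFormallyEven.existsUnique_isInvXExpansion` —
  **existence** when `2` is a non-zero-divisor of `R` (e.g. any `ℚ`-algebra, any domain of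
  characteristic `≠ 2`): an even `Σ` is `𝔖(1/x)` for a unique `𝔖 ∈ R⟦w⟧` — the formal-group content of
  «`z` is quadratic over `R⟦1/x⟧` with conjugate `i(z)`, so the `i`-invariants are `R⟦1/x⟧`»; built
  degree by degree (`S_{n+1} = S_n + c•wⁿ` kills `[z^{2n}]`, parity kills `[z^{2n+1}]`).
* `isInvXExpansion_padicSigmaSqInvX_of_isFormallyEven`, `…_of_exists_pair` — **over `ℚ_p` the tree's
  `𝔖_p = padicSigmaSqInvX V p` is THE expansion of `Σ_p = padicSigmaSq (V ⊗ ℚ_p)`** as soon as `Σ_p` is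
  even, in particular whenever `V ⊗ ℚ_p` carries a Mazur–Tate pair or a sigma-squared pair
  (`isMazurTateSigmaSqPair_padicSigmaSq`; at `p = 2` good ordinary: Silverman 2005 §5 Rem. 2 — `σ²` is
  the well-defined, EVEN object). So the (U5d) receptacle `canonicalPAdicHeightSqMinusTwist` reads a
  genuine `𝔖_p`, not junk.

Nothing about BSD is proved here.

## References

* J. H. Silverman, *The Arithmetic of Elliptic Curves*, 2nd ed. (2009), IV.1 (formal group: `x = z/w`,
  `w/z³`, the inverse `i(z) = −z − a₁z² − ⋯`, `x(i(z)) = x(z)`). [SilvermanAEC2009]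
* J. H. Silverman, *p-adic properties of division polynomials and elliptic divisibility sequences*,
  Math. Ann. 332 (2005), §5 Thm. 11 and Rem. 2 (`σ²` even; well defined at `p = 2`). [Silverman2005DivPoly]
* B. Mazur, J. Tate, *The p-adic sigma function*, Duke Math. J. 62 (1991), Thm. 3.1 (σ odd; at `p = 2`
  only `σ²`). [MazurTate1991]
* B. Mazur, W. Stein, J. Tate, *Computation of p-adic heights and log convergence* (2006), §1 (1.1),
  Thm. 1.3. [MazurSteinTate2006]
-/

noncomputable section

open scoped Classical
open PowerSeries Literature.NumberTheory.EllipticCurves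

namespace WeierstrassCurve

section Ring

variable {R : Type*} [CommRing R] (W : WeierstrassCurve R)

/-! ### §0 Coefficient plumbing (private) -/

/-- `ord(g^d) ≥ d` for `g(0) = 0` (private plumbing). [folklore] -/
private theorem le_order_pow_of_constantCoeff_eq_zero' {g : R⟦X⟧} (hg : constantCoeff g = 0) (d : ℕ) :
    (d : ℕ∞) ≤ (g ^ d).order := by
  have h1 : (1 : ℕ∞) ≤ g.order := (one_le_order_iff_constCoeff_eq_zero).mpr hg
  calc (d : ℕ∞) = d • (1 : ℕ∞) := by simp
    _ ≤ d • g.order := nsmul_le_nsmul_right h1 d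
    _ ≤ (g ^ d).order := le_order_pow g d

/-- `[zⁿ](g^k) = 0` for `n < k` when `g(0) = 0` (private plumbing). [folklore] -/
private theorem coeff_pow_eq_zero_of_lt {g : R⟦X⟧} (hg : constantCoeff g = 0) {n k : ℕ} (h : n < k) :
    coeff n (g ^ k) = 0 :=
  coeff_of_lt_order n (lt_of_lt_of_le (by exact_mod_cast h) (le_order_pow_of_constantCoeff_eq_zero' hg k))

/-- `[zⁿ] f(g) = Σ_{k ≤ n} f_k · [zⁿ] g^k` for `g(0) = 0` (private plumbing; the finite-support form of
Mathlib's `coeff_subst'`). [folklore] -/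
private theorem coeff_subst_eq_sum_range'' (f : R⟦X⟧) {g : R⟦X⟧} (hg : constantCoeff g = 0) (n : ℕ) :
    coeff n (f.subst g) = ∑ k ∈ Finset.range (n + 1), coeff k f * coeff n (g ^ k) := by
  rw [coeff_subst' (HasSubst.of_constantCoeff_zero' hg),
    finsum_eq_sum_of_support_subset _ (s := Finset.range (n + 1)) ?_]
  · exact Finset.sum_congr rfl fun d _ ↦ by rw [smul_eq_mul]
  · intro d hd
    rw [Function.mem_support] at hd
    rw [Finset.coe_range, Set.mem_Iio]
    by_contra h
    apply hd
    rw [coeff_pow_eq_zero_of_lt hg (Nat.lt_of_succ_le (not_lt.mp h)), smul_zero]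

/-- `[z^k](g^k) = ([z¹]g)^k` for `g(0) = 0` (private plumbing). [folklore] -/
private theorem coeff_pow_self_of_constantCoeff_zero {g : R⟦X⟧} (hg : constantCoeff g = 0) (k : ℕ) :
    coeff k (g ^ k) = (coeff 1 g) ^ k := by
  obtain ⟨h, rfl⟩ := X_dvd_iff.mpr hg
  rw [mul_pow, coeff_X_pow_mul', if_pos le_rfl, Nat.sub_self, coeff_zero_eq_constantCoeff_apply, map_pow,
    coeff_succ_X_mul, coeff_zero_eq_constantCoeff_apply]

/-! ### §1 `1/x` is invariant under the formal inverse; `S(1/x)` is even -/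

/-- **`(1/x)(i(z)) = (1/x)(z)`**: the function `1/x` on the formal group is invariant under the inverse
(`x(−P) = x(P)`; in series: `x(i(z)) = x(z)`, tree `formalXMulSq_subst_formalNeg_mul_X_sq`, and
`1/x = z²·(w/z³)` with `(z²x)·(w/z³) = 1`). [cite: SilvermanAEC2009, IV.1.1] -/
theorem formalInvX_subst_formalNeg : W.formalInvX.subst W.formalNeg = W.formalInvX := by
  have hs := W.hasSubst_formalNeg
  have hXi := W.formalXMulSq_subst_formalNeg_mul_X_sq
  have hBX := W.formalWDivCube_mul_formalXMulSq
  -- `B(i) · X(i) = 1`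
  have hBXi : W.formalWDivCube.subst W.formalNeg * W.formalXMulSq.subst W.formalNeg = 1 := by
    rw [← subst_mul hs, hBX, ← coe_substAlgHom hs, map_one]
  rw [formalInvX, subst_mul hs, subst_pow hs, subst_X hs]
  linear_combination (-(W.formalNeg ^ 2 * W.formalWDivCube.subst W.formalNeg)) * hBX +
    (-(W.formalWDivCube * W.formalWDivCube.subst W.formalNeg)) * hXi +
    (X ^ 2 * W.formalWDivCube) * hBXi

/-- `(1/x)^k` is invariant under the formal inverse. [cite: SilvermanAEC2009, IV.1.1] -/
theorem formalInvX_pow_subst_formalNeg (k : ℕ) :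
    (W.formalInvX ^ k).subst W.formalNeg = W.formalInvX ^ k := by
  rw [subst_pow W.hasSubst_formalNeg, formalInvX_subst_formalNeg]

variable {W} in
/-- **Every series in `1/x` is EVEN**: if `S(1/x(z)) = Σ(z)` then `Σ(i(z)) = Σ(z)`.
[cite: SilvermanAEC2009, IV.1.1] [cite: Silverman2005DivPoly, §5 Rem. 2] -/
theorem IsInvXExpansion.isFormallyEven {Sq S : R⟦X⟧} (h : W.IsInvXExpansion Sq S) :
    W.IsFormallyEven Sq := by
  rw [IsFormallyEven, ← h, subst_comp_subst_apply W.hasSubst_formalInvX W.hasSubst_formalNeg,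
    formalInvX_subst_formalNeg]

/-! ### §2 Coefficients of `(1/x)^k` and of `S(1/x)` -/

/-- `[z^j]((1/x)^k) = 0` for `j < 2k` (`1/x = z² + ⋯`). [cite: SilvermanAEC2009, IV.1.1] -/
theorem coeff_formalInvX_pow_eq_zero_of_lt {j k : ℕ} (h : j < 2 * k) : coeff j (W.formalInvX ^ k) = 0 := by
  rw [formalInvX, mul_pow, ← pow_mul, coeff_X_pow_mul', if_neg (by omega)]

/-- `[z^{2k}]((1/x)^k) = 1` (`w/z³ = 1 + ⋯`). [cite: SilvermanAEC2009, IV.1.1] -/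
theorem coeff_formalInvX_pow_self (k : ℕ) : coeff (2 * k) (W.formalInvX ^ k) = 1 := by
  rw [formalInvX, mul_pow, ← pow_mul, coeff_X_pow_mul', if_pos le_rfl, Nat.sub_self,
    coeff_zero_eq_constantCoeff, map_pow, constantCoeff_formalWDivCube, one_pow]

/-- **`[zⁿ] S(1/x) = Σ_{k ≤ n} S_k · [zⁿ](1/x)^k`** (finitely many terms). [cite: SilvermanAEC2009, IV.1.1] -/
theorem coeff_subst_formalInvX (S : R⟦X⟧) (n : ℕ) :
    coeff n (S.subst W.formalInvX) =
      ∑ k ∈ Finset.range (n + 1), coeff k S * coeff n (W.formalInvX ^ k) :=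
  coeff_subst_eq_sum_range'' S W.constantCoeff_formalInvX n

/-- The even coefficient: **`[z^{2n}] S(1/x) = S_n + Σ_{k < n} S_k · [z^{2n}](1/x)^k`** (the terms
`k > n` vanish, the term `k = n` is `S_n`). [cite: SilvermanAEC2009, IV.1.1] -/
theorem coeff_two_mul_subst_formalInvX (S : R⟦X⟧) (n : ℕ) :
    coeff (2 * n) (S.subst W.formalInvX) =
      coeff n S + ∑ k ∈ Finset.range n, coeff k S * coeff (2 * n) (W.formalInvX ^ k) := by
  rw [coeff_subst_formalInvX]
  have hsplit : Finset.range (2 * n + 1) = Finset.range (n + 1) ∪ Finset.Ico (n + 1) (2 * n + 1) := by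
    rw [Finset.range_eq_Ico, Finset.range_eq_Ico,
      Finset.Ico_union_Ico_eq_Ico (Nat.zero_le _) (by omega)]
  rw [hsplit, Finset.sum_union (by
    rw [Finset.range_eq_Ico]; exact Finset.Ico_disjoint_Ico_consecutive 0 (n + 1) (2 * n + 1))]
  have hzero : ∑ k ∈ Finset.Ico (n + 1) (2 * n + 1), coeff k S * coeff (2 * n) (W.formalInvX ^ k) = 0 :=
    Finset.sum_eq_zero fun k hk => by
      rw [Finset.mem_Ico] at hk
      rw [coeff_formalInvX_pow_eq_zero_of_lt W (by omega), mul_zero]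
  rw [hzero, add_zero, Finset.sum_range_succ, coeff_formalInvX_pow_self, mul_one, add_comm]

/-! ### §3 Parity: an even series has no odd leading term (when `2` is regular) -/

variable {W} in
/-- **Lowest term of `T(i(z))`**: if `[z^j]T = 0` for all `j < m` then `[z^m] T(i(z)) = (−1)^m [z^m]T`
(`i(z) = −z + ⋯`). [cite: SilvermanAEC2009, IV.1.1] -/
theorem coeff_subst_formalNeg_of_forall_lt {T : R⟦X⟧} {m : ℕ} (hT : ∀ j < m, coeff j T = 0) :
    coeff m (T.subst W.formalNeg) = (-1) ^ m * coeff m T := by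
  have hz : ∑ k ∈ Finset.range m, coeff k T * coeff m (W.formalNeg ^ k) = 0 :=
    Finset.sum_eq_zero fun k hk => by rw [hT k (Finset.mem_range.mp hk), zero_mul]
  rw [coeff_subst_eq_sum_range'' T W.constantCoeff_formalNeg, Finset.sum_range_succ, hz, zero_add,
    coeff_pow_self_of_constantCoeff_zero W.constantCoeff_formalNeg, coeff_one_formalNeg, mul_comm]

variable {W} in
/-- **Parity.** An EVEN series (`T(i(z)) = T(z)`) whose coefficients vanish below an ODD degree `m` has
`2·[z^m]T = 0` (so `[z^m]T = 0` when `2` is a non-zero-divisor): an `i`-invariant series has even order.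
[cite: Silverman2005DivPoly, §5 Rem. 2] [cite: MazurTate1991, Thm. 3.1] -/
theorem IsFormallyEven.two_mul_coeff_eq_zero {T : R⟦X⟧} (heven : W.IsFormallyEven T) {m : ℕ}
    (hm : Odd m) (hT : ∀ j < m, coeff j T = 0) : 2 * coeff m T = 0 := by
  have h := congrArg (coeff m) heven
  rw [coeff_subst_formalNeg_of_forall_lt hT, hm.neg_one_pow] at h
  linear_combination -h

/-! ### §4 Uniqueness: `S ↦ S(1/x)` is injective (any commutative ring) -/

/-- **Triangularity.** If `[z^j] D(1/x) = 0` for all `j < 2n` then `[w^k]D = 0` for all `k < n`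
(induction on `k`: `[z^{2k}]D(1/x) = D_k + Σ_{l<k} D_l·(⋯)`). [cite: SilvermanAEC2009, IV.1.1] -/
theorem coeff_eq_zero_of_coeff_subst_formalInvX_eq_zero (D : R⟦X⟧) (n : ℕ)
    (h : ∀ j < 2 * n, coeff j (D.subst W.formalInvX) = 0) : ∀ k < n, coeff k D = 0 := by
  intro k
  induction k using Nat.strong_induction_on with
  | _ k ih =>
    intro hk
    have hk2 := h (2 * k) (by omega)
    have hz : ∑ l ∈ Finset.range k, coeff l D * coeff (2 * k) (W.formalInvX ^ l) = 0 :=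
      Finset.sum_eq_zero fun l hl => by
        have hl' := Finset.mem_range.mp hl
        rw [ih l hl' (by omega), zero_mul]
    rw [coeff_two_mul_subst_formalInvX, hz, add_zero] at hk2
    exact hk2

variable {W} in
/-- **Uniqueness of the `x⁻¹`-expansion** (any commutative ring): `S(1/x) = S′(1/x) ⇒ S = S′`.
[cite: SilvermanAEC2009, IV.1.1] [cite: Silverman2005DivPoly, §5 Rem. 2] -/
theorem IsInvXExpansion.unique {Sq S S' : R⟦X⟧} (h : W.IsInvXExpansion Sq S)
    (h' : W.IsInvXExpansion Sq S') : S = S' := by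
  rw [← sub_eq_zero]
  ext k
  rw [map_zero]
  have he : S.subst W.formalInvX = Sq := h
  have he' : S'.subst W.formalInvX = Sq := h'
  refine coeff_eq_zero_of_coeff_subst_formalInvX_eq_zero W (S - S') (k + 1) (fun j _ => ?_) k
    (Nat.lt_succ_self k)
  rw [subst_sub W.hasSubst_formalInvX, map_sub, he, he', sub_self]

/-! ### §5 Existence (when `2` is a non-zero-divisor) -/

variable {W} in
/-- **Truncated expansions exist.** For an even `Σ` and every `n` there is `Sₙ` with
`[z^j](Σ − Sₙ(1/x)) = 0` for all `j < 2n` (`2` a non-zero-divisor of `R`). Step: with `c = [z^{2n}]` of the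
remainder, `S_{n+1} = Sₙ + c•wⁿ` kills degree `2n`, and the remainder — still even — has no `z^{2n+1}`
term by parity. [cite: Silverman2005DivPoly, §5 Rem. 2] [cite: SilvermanAEC2009, IV.1.1] -/
theorem IsFormallyEven.exists_truncated_invXExpansion (h2 : IsLeftRegular (2 : R)) {Sq : R⟦X⟧}
    (heven : W.IsFormallyEven Sq) (n : ℕ) :
    ∃ S : R⟦X⟧, ∀ j < 2 * n, coeff j (Sq - S.subst W.formalInvX) = 0 := by
  have hs := W.hasSubst_formalInvX
  induction n with
  | zero => exact ⟨0, fun j hj => absurd hj (by omega)⟩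
  | succ n ih =>
    obtain ⟨S, hS⟩ := ih
    set c : R := coeff (2 * n) (Sq - S.subst W.formalInvX) with hc
    refine ⟨S + c • X ^ n, ?_⟩
    -- the new remainder
    have hrem : Sq - (S + c • X ^ n).subst W.formalInvX =
        (Sq - S.subst W.formalInvX) - c • W.formalInvX ^ n := by
      rw [subst_add hs, subst_smul hs, subst_pow hs, subst_X hs]; ring
    -- it is even
    have hev : W.IsFormallyEven (Sq - (S + c • X ^ n).subst W.formalInvX) := by
      rw [hrem, IsFormallyEven, subst_sub W.hasSubst_formalNeg, subst_sub W.hasSubst_formalNeg,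
        subst_smul W.hasSubst_formalNeg, formalInvX_pow_subst_formalNeg,
        subst_comp_subst_apply hs W.hasSubst_formalNeg, formalInvX_subst_formalNeg]
      rw [IsFormallyEven] at heven
      rw [heven]
    -- coefficients below `2n + 1`
    have hlow : ∀ j < 2 * n + 1, coeff j (Sq - (S + c • X ^ n).subst W.formalInvX) = 0 := by
      intro j hj
      rw [hrem, map_sub, map_smul, smul_eq_mul]
      rcases Nat.lt_succ_iff_lt_or_eq.mp hj with hj' | rfl
      · rw [hS j hj', coeff_formalInvX_pow_eq_zero_of_lt W hj', mul_zero, sub_zero]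
      · rw [coeff_formalInvX_pow_self, mul_one, ← hc, sub_self]
    -- the odd coefficient `2n + 1` by parity
    have h2c : 2 * coeff (2 * n + 1) (Sq - (S + c • X ^ n).subst W.formalInvX) = 0 :=
      hev.two_mul_coeff_eq_zero ⟨n, rfl⟩ hlow
    have hodd : coeff (2 * n + 1) (Sq - (S + c • X ^ n).subst W.formalInvX) = 0 :=
      h2 (h2c.trans (mul_zero (2 : R)).symm)
    intro j hj
    rcases Nat.lt_succ_iff_lt_or_eq.mp (show j < 2 * n + 1 + 1 by omega) with hj' | rfl
    · exact hlow j hj'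
    · exact hodd

variable {W} in
/-- Two truncated expansions of levels `≥ n` agree below `n`. [cite: SilvermanAEC2009, IV.1.1] -/
theorem coeff_eq_of_truncated_invXExpansion {Sq S S' : R⟦X⟧} {n : ℕ}
    (hS : ∀ j < 2 * n, coeff j (Sq - S.subst W.formalInvX) = 0)
    (hS' : ∀ j < 2 * n, coeff j (Sq - S'.subst W.formalInvX) = 0) : ∀ k < n, coeff k S = coeff k S' := by
  intro k hk
  rw [← sub_eq_zero, ← map_sub]
  refine coeff_eq_zero_of_coeff_subst_formalInvX_eq_zero W (S - S') n (fun j hj => ?_) k hk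
  have h1 := hS j hj
  have h2 := hS' j hj
  rw [map_sub] at h1 h2
  rw [subst_sub W.hasSubst_formalInvX, map_sub]
  linear_combination h2 - h1

variable {W} in
/-- **Existence of the `x⁻¹`-expansion of an even series** (`2` a non-zero-divisor of `R`, e.g. `R` a
`ℚ`-algebra or a domain of characteristic `≠ 2`): if `Σ(i(z)) = Σ(z)` then `Σ = 𝔖(1/x(z))` for some
`𝔖 ∈ R⟦w⟧` — the `i`-invariant formal functions are the functions of `x`. (The coefficients of `𝔖` are
read off the truncations of §5, which are coherent by §4.)
[cite: Silverman2005DivPoly, §5 Rem. 2] [cite: SilvermanAEC2009, IV.1.1] -/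
theorem IsFormallyEven.exists_isInvXExpansion (h2 : IsLeftRegular (2 : R)) {Sq : R⟦X⟧}
    (heven : W.IsFormallyEven Sq) : ∃ S : R⟦X⟧, W.IsInvXExpansion Sq S := by
  choose T hT using heven.exists_truncated_invXExpansion h2
  -- coherent coefficients
  set s : ℕ → R := fun k => coeff k (T (k + 1)) with hs
  have hcoh : ∀ n k, k < n → coeff k (T n) = s k := fun n k hk =>
    coeff_eq_of_truncated_invXExpansion (n := k + 1)
      (fun j hj => hT n j (by omega)) (fun j hj => hT (k + 1) j hj) k (Nat.lt_succ_self k)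
  refine ⟨PowerSeries.mk s, ?_⟩
  rw [IsInvXExpansion]
  ext j
  -- compare with the truncation of level `j + 1`
  have hagree : coeff j ((PowerSeries.mk s).subst W.formalInvX) =
      coeff j ((T (j + 1)).subst W.formalInvX) := by
    rw [coeff_subst_formalInvX, coeff_subst_formalInvX]
    refine Finset.sum_congr rfl fun k hk => ?_
    by_cases hkj : j < 2 * k
    · rw [coeff_formalInvX_pow_eq_zero_of_lt W hkj, mul_zero, mul_zero]
    · rw [coeff_mk, hcoh (j + 1) k (by omega)]
  have h := hT (j + 1) j (by omega)
  rw [map_sub, sub_eq_zero] at h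
  rw [hagree, ← h]

variable {W} in
/-- **Existence and uniqueness of the `x⁻¹`-expansion** of an even series (`2` a non-zero-divisor).
[cite: Silverman2005DivPoly, §5 Rem. 2] [cite: SilvermanAEC2009, IV.1.1] -/
theorem IsFormallyEven.existsUnique_isInvXExpansion (h2 : IsLeftRegular (2 : R)) {Sq : R⟦X⟧}
    (heven : W.IsFormallyEven Sq) : ∃! S : R⟦X⟧, W.IsInvXExpansion Sq S := by
  obtain ⟨S, hS⟩ := heven.exists_isInvXExpansion h2
  exact ⟨S, hS, fun S' hS' => hS'.unique hS⟩

/-- **`Σ` is even iff it is a series in `1/x`** (`2` a non-zero-divisor).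
[cite: Silverman2005DivPoly, §5 Rem. 2] [cite: SilvermanAEC2009, IV.1.1] -/
theorem isFormallyEven_iff_exists_isInvXExpansion (h2 : IsLeftRegular (2 : R)) (Sq : R⟦X⟧) :
    W.IsFormallyEven Sq ↔ ∃ S : R⟦X⟧, W.IsInvXExpansion Sq S :=
  ⟨fun h => h.exists_isInvXExpansion h2, fun ⟨_, hS⟩ => hS.isFormallyEven⟩

end Ring

/-! ### §6 Over `ℚ_p`: `𝔖_p = padicSigmaSqInvX` is THE expansion of `Σ_p` whenever `Σ_p` is even -/

section Padic

variable (V : WeierstrassCurve ℚ) (p : ℕ) [Fact p.Prime]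

/-- `2` is a non-zero-divisor of `ℚ_p` (a field of characteristic `0`; private plumbing). [folklore] -/
private theorem isLeftRegular_two_padic : IsLeftRegular (2 : ℚ_[p]) :=
  fun _ _ h => mul_left_cancel₀ (two_ne_zero : (2 : ℚ_[p]) ≠ 0) h

variable {V p} in
/-- **`𝔖_p(1/x(z)) = Σ_p(z)` as soon as `Σ_p` is even**: the tree's `padicSigmaSqInvX V p` (chosen by
`Classical.choose`) is then a genuine `x⁻¹`-expansion of `padicSigmaSq (V ⊗ ℚ_p)`, and the unique one.
[cite: Silverman2005DivPoly, §5 Rem. 2] [cite: MazurSteinTate2006, Thm. 1.3] -/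
theorem isInvXExpansion_padicSigmaSqInvX_of_isFormallyEven
    (heven : (V.baseChange ℚ_[p]).IsFormallyEven (V.baseChange ℚ_[p]).padicSigmaSq) :
    (V.baseChange ℚ_[p]).IsInvXExpansion (V.baseChange ℚ_[p]).padicSigmaSq (V.padicSigmaSqInvX p) :=
  isInvXExpansion_padicSigmaSqInvX (heven.exists_isInvXExpansion (isLeftRegular_two_padic p))

variable {V p} in
/-- **`𝔖_p` is THE `x⁻¹`-expansion of `Σ_p` whenever `V ⊗ ℚ_p` carries a Mazur–Tate pair or a
sigma-squared pair** (every good ordinary `p`, `p = 2` included once the squared pair is supplied —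
e.g. `49a1` and its twists at `2` by the tree's CM sigma function): then `(Σ_p, c)` is a sigma-squared
pair (`isMazurTateSigmaSqPair_padicSigmaSq`), in particular even, and §5 applies.
[cite: Silverman2005DivPoly, §5 Thm. 11 and Rem. 2] [cite: MazurSteinTate2006, Thm. 1.3] -/
theorem isInvXExpansion_padicSigmaSqInvX_of_exists_pair
    (h : (∃ σ : ℚ_[p]⟦X⟧, ∃ c : ℚ_[p], (V.baseChange ℚ_[p]).IsMazurTateSigmaPair σ c) ∨
      ∃ Sq : ℚ_[p]⟦X⟧, ∃ c : ℚ_[p], (V.baseChange ℚ_[p]).IsMazurTateSigmaSqPair Sq c) :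
    (V.baseChange ℚ_[p]).IsInvXExpansion (V.baseChange ℚ_[p]).padicSigmaSq (V.padicSigmaSqInvX p) :=
  isInvXExpansion_padicSigmaSqInvX_of_isFormallyEven (isMazurTateSigmaSqPair_padicSigmaSq h).even

variable {V p} in
/-- Uniqueness over `ℚ_p`: any `x⁻¹`-expansion of `Σ_p` IS `𝔖_p`. [cite: Silverman2005DivPoly, §5 Rem. 2] -/
theorem eq_padicSigmaSqInvX_of_isInvXExpansion {S : ℚ_[p]⟦X⟧}
    (hS : (V.baseChange ℚ_[p]).IsInvXExpansion (V.baseChange ℚ_[p]).padicSigmaSq S) :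
    S = V.padicSigmaSqInvX p :=
  hS.unique (isInvXExpansion_padicSigmaSqInvX ⟨S, hS⟩)

end Padic

end WeierstrassCurve

end
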